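import Summits.QuantumFields.BalabanUV.T4Continuum.Spine.NE1p.TiltedMeanSmoothDual

/-!
# T⁴ programme, spine estimate NE1′ (node O3b/H2) — THE FLATNESS CHANNEL RE-LINEARISED: one cascade step makes the first-order
# term of the fibred swap second order (`θ·θ'`) when the slot's conditional-mean discrepancy is centred over the next-level exterior

Cell `pub-balaban-gaps` (YM blitz Y1, track G2), seat `ne1` gen 6 (prover-pub-balaban-gaps-ne1-g6-0), record `HOME/ne/NE1.md` §4 row R45
(gen 6).  ADDITIVE — imports the sibling `TiltedMeanSmoothDual` (same generation) ONLY, for Mathlib and the namespace lineage; uses no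
declaration of it (pure finite sums); modifies nothing.  Second sibling: `TiltedMeanSmoothDualTilt`.

WHAT THIS IS.  The sibling's fibred swap (`TiltedMeanSmoothDual.abs_fibred_swap_le`) bounds the influence of one slot on a smooth test
function by a FIRST-order term — `G₁·|θ|·Σ_u ν_u |δ(u)|`, `δ(u)` = the fibrewise conditional-mean discrepancy of the slot's linear image
given the exterior `u` (the FLATNESS channel: zero at conjugation-invariant exteriors, NOT zero off the flat orbit, NE1.md R28 (2)∕R34) —
plus a second-order term.  The record books the flatness channel by a «re-linearisation» at later scales (R28 (γ), the O-γ2 ledger: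
«constants-at-1 ≡ 0, regenerated constants = covariances ≍ θ₁^{(K−j)+(K−k)}»): the discrepancy `δ` is driven by the CURVATURE of the
exterior near the slot, i.e. by YOUNGER fluctuation variables, and is itself centred over them by the same symmetry one level up.  This
file is that step as a theorem of the finite model:
* `abs_fibred_swap_two_level_le` — exterior split into a next-level variable `w` (conditional weights `ρ u w`) and the rest `u`; slot
  kernels depending on both; unit field `m u + θ'·ℓ' w + θ·ℓ v`; test function with `|g'| ≤ G₁`, `g'` `G₂`-Lipschitz, Taylor majorant
  `G₂`: `|swap| ≤ G₁|θ|·Σ_u ν_u |Σ_w ρ_{uw} δ(u,w)| + G₂|θ||θ'|·Σ_u ν_u Σ_w ρ_{uw} |δ(u,w)|·|ℓ' w| + G₂θ²·(second moments)` — the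
  first-order term now carries the discrepancy AVERAGED over the next-level variable;
* `abs_fibred_swap_two_level_le_of_centred` — if that average vanishes for every `u` (idealised: the conditional-mean shift is
  EXACTLY a centred functional of the younger fluctuation), the swap is SECOND order: `θ·θ'` (slot transfer × next-level transfer,
  against `E|δ·ℓ'|`) plus `θ²`; in general the averaged discrepancy is the explicit first-order coefficient the producer must show
  small (leading order: symmetry one level up; residual: R28 (2)'s regenerated constant, booked by the coupling profile at birth).
CONSEQUENCE FOR THE ROW (NE1.md v6 R45).  The one item of R28 booked as «bookkeeping» (O-γ2) has a kernel form in the smooth-dual currency: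
each re-linearisation step trades a first-order flatness term for {the same term averaged one level up} + {a product of two transfer
rates}.  Iterating over the levels `j < j' < j'' < …` is finite-sum bookkeeping of the same shape (not typed: no new content); what the
producer owes per step is the SMALLNESS of the averaged discrepancy (centred at leading order by symmetry — kernel `T4AdInvariant` in
the gauge setting —, residual = the regenerated constant of R28 (2)) and the locality∕multiplicity of the younger drivers (NODE O's
census; [B13] §§1–2 KIND for the far ones).  Classification of NE1′ UNCHANGED:
WORK-bound ∕ OBJECT-bound ∕ NOT idea-bound.

HONEST FRAMING.  [folklore] finite-sum algebra and the mean value inequality's consequences (taken as hypotheses on `g`) over ABSTRACT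
data; a MODEL (two-level fibration, linearised transfers), NOT Bałaban's class-conditioned law; the identification «`w` = the younger
fluctuation driving the slot's conditional-mean shift» is this seat's READING of R28 (2); nothing of Bałaban's asserted or instantiated.
NE1′ NOT proved; spine 0∕9; (B) 0∕13; one fixed finite T⁴ — NOT ℝ⁴, NOT infinite volume, NOT a mass gap, NOT Clay.  0 sorry.
-/

noncomputable section

open Finset
open scoped BigOperators

namespace Summit.QuantumFields.BalabanUV.T4Continuum.NE1p.TiltedMeanSmoothDualCascade

/-! ## §1 One cascade step on the fibred swap -/

section Cascade

variable {U W V : Type*} {EU : Finset U} {EW : Finset W} {EV : Finset V}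
  {ν : U → ℝ} {ρ : U → W → ℝ} {κA κB : U → W → V → ℝ} {m : U → ℝ} {ℓ' : W → ℝ} {ℓ : V → ℝ} {θ θ' : ℝ}
  {g g' : ℝ → ℝ} {G₁ G₂ : ℝ}

/-- **THE TWO-LEVEL FIBRED SWAP (RE-LINEARISATION OF THE FLATNESS CHANNEL).**  Finite model of ONE slot `v` whose exterior is split
into a NEXT-LEVEL variable `w ∈ EW` (the nearby younger fluctuation that drives the slot's conditional-mean shift; conditional weights
`ρ u w ≥ 0` given the rest) and the rest `u ∈ EU` (weights `ν u ≥ 0`); slot kernels `κA u w ·` (off) ∕ `κB u w ·` (on) depend on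
BOTH, with equal fibre masses; the unit field is `m u + θ'·ℓ' w + θ·ℓ v` (both transfers linearised, rates `θ'` for the next-level
variable and `θ` for the slot).  For a test function with `|g'| ≤ G₁`, a `G₂`-Lipschitz derivative and the Taylor majorant `G₂`:
`|Σ_u ν_u Σ_w ρ_{uw} Σ_v (κB − κA)(u,w,v)·g(m u + θ'ℓ' w + θ ℓ v)|`
`  ≤ G₁·|θ|·Σ_u ν_u·|Σ_w ρ_{uw}·δ(u,w)| + G₂·|θ|·|θ'|·Σ_u ν_u Σ_w ρ_{uw}·|δ(u,w)|·|ℓ' w| + G₂·θ²·Σ_u ν_u Σ_w ρ_{uw} Σ_v (κA + κB)·ℓ v²`,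
where `δ(u,w) = Σ_v (κB − κA)(u,w,v)·ℓ v` is the slot's fibrewise conditional-mean discrepancy.  The FIRST term is the flatness channel
AVERAGED over the next-level variable — the quantity the producer must show small (at leading order it vanishes when the
conditional-mean shift is a centred functional of the younger fluctuation: conjugation symmetry one level up, NE1.md R28 (2)∕(γ); its
residual is R28 (2)'s «regenerated constant», booked there by the coupling profile at birth); what remains is SECOND order: `θ·θ'`
(slot transfer × next-level transfer) and `θ²`.  This is the O-γ2 «re-linearisation» step of the record as a theorem of the finite
model: NO smoothness of any law, NO independence, NO expansion. [folklore] -/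
theorem abs_fibred_swap_two_level_le
    (hν : ∀ u ∈ EU, 0 ≤ ν u) (hρ : ∀ u ∈ EU, ∀ w ∈ EW, 0 ≤ ρ u w)
    (hκA : ∀ u ∈ EU, ∀ w ∈ EW, ∀ v ∈ EV, 0 ≤ κA u w v) (hκB : ∀ u ∈ EU, ∀ w ∈ EW, ∀ v ∈ EV, 0 ≤ κB u w v)
    (hmass : ∀ u ∈ EU, ∀ w ∈ EW, ∑ v ∈ EV, κA u w v = ∑ v ∈ EV, κB u w v)
    (hg : ∀ x h : ℝ, |g (x + h) - g x - h * g' x| ≤ G₂ * h ^ 2) (hg' : ∀ x, |g' x| ≤ G₁)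
    (hg'L : ∀ x y : ℝ, |g' x - g' y| ≤ G₂ * |x - y|) :
    |∑ u ∈ EU, ν u * ∑ w ∈ EW, ρ u w * ∑ v ∈ EV, (κB u w v - κA u w v) * g (m u + θ' * ℓ' w + θ * ℓ v)|
      ≤ G₁ * |θ| * ∑ u ∈ EU, ν u * |∑ w ∈ EW, ρ u w * ∑ v ∈ EV, (κB u w v - κA u w v) * ℓ v|
        + G₂ * |θ| * |θ'| * ∑ u ∈ EU, ν u * ∑ w ∈ EW, ρ u w * (|∑ v ∈ EV, (κB u w v - κA u w v) * ℓ v| * |ℓ' w|)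
        + G₂ * θ ^ 2 * ∑ u ∈ EU, ν u * ∑ w ∈ EW, ρ u w * ∑ v ∈ EV, (κA u w v + κB u w v) * ℓ v ^ 2 := by
  have hG₁ : 0 ≤ G₁ := (abs_nonneg _).trans (hg' 0)
  have hG₂ : 0 ≤ G₂ := by
    have h1 := hg'L 1 0
    rw [sub_zero, abs_one, mul_one] at h1
    exact (abs_nonneg _).trans h1
  -- abbreviation: the fibrewise discrepancy and the second-moment sum
  set δ : U → W → ℝ := fun u w => ∑ v ∈ EV, (κB u w v - κA u w v) * ℓ v with hδ
  set μ₂ : U → W → ℝ := fun u w => ∑ v ∈ EV, (κA u w v + κB u w v) * ℓ v ^ 2 with hμ₂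
  -- (1) one inner fibre (u, w): Taylor on `g` at the point `m u + θ' ℓ' w`
  have hinner : ∀ u ∈ EU, ∀ w ∈ EW,
      |∑ v ∈ EV, (κB u w v - κA u w v) * g (m u + θ' * ℓ' w + θ * ℓ v)
        - θ * g' (m u + θ' * ℓ' w) * δ u w| ≤ G₂ * θ ^ 2 * μ₂ u w := by
    intro u hu w hw
    set x := m u + θ' * ℓ' w with hx
    set R : V → ℝ := fun v => g (x + θ * ℓ v) - g x - θ * ℓ v * g' x with hR
    have hRb : ∀ v, |R v| ≤ G₂ * (θ * ℓ v) ^ 2 := fun v => hg x (θ * ℓ v)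
    have hsplit : ∑ v ∈ EV, (κB u w v - κA u w v) * g (x + θ * ℓ v) - θ * g' x * δ u w
        = g x * (∑ v ∈ EV, κB u w v - ∑ v ∈ EV, κA u w v) + ∑ v ∈ EV, (κB u w v - κA u w v) * R v := by
      simp only [hδ, hR, mul_sum, ← sum_sub_distrib, ← sum_add_distrib]
      refine sum_congr rfl fun v _ => ?_
      ring
    rw [hsplit, ← hmass u hu w hw, sub_self, mul_zero, zero_add]
    calc |∑ v ∈ EV, (κB u w v - κA u w v) * R v|
        ≤ ∑ v ∈ EV, |(κB u w v - κA u w v) * R v| := abs_sum_le_sum_abs _ _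
      _ ≤ ∑ v ∈ EV, (κA u w v + κB u w v) * (G₂ * (θ * ℓ v) ^ 2) := by
          refine sum_le_sum fun v hv => ?_
          rw [abs_mul]
          refine mul_le_mul ?_ (hRb v) (abs_nonneg _) (add_nonneg (hκA u hu w hw v hv) (hκB u hu w hw v hv))
          have hA := hκA u hu w hw v hv
          have hB := hκB u hu w hw v hv
          rw [abs_le]; constructor <;> linarith
      _ = G₂ * θ ^ 2 * μ₂ u w := by
          simp only [hμ₂, mul_sum]
          refine sum_congr rfl fun v _ => ?_
          ring
  -- (2) one outer fibre u: re-linearise `g'` at `m u` across the next-level variable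
  have houter : ∀ u ∈ EU,
      |∑ w ∈ EW, ρ u w * ∑ v ∈ EV, (κB u w v - κA u w v) * g (m u + θ' * ℓ' w + θ * ℓ v)|
        ≤ G₁ * |θ| * |∑ w ∈ EW, ρ u w * δ u w|
          + G₂ * |θ| * |θ'| * ∑ w ∈ EW, ρ u w * (|δ u w| * |ℓ' w|)
          + G₂ * θ ^ 2 * ∑ w ∈ EW, ρ u w * μ₂ u w := by
    intro u hu
    -- split each inner sum into its linear part and the Taylor remainder
    have hdecomp : ∑ w ∈ EW, ρ u w * ∑ v ∈ EV, (κB u w v - κA u w v) * g (m u + θ' * ℓ' w + θ * ℓ v)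
        = θ * g' (m u) * ∑ w ∈ EW, ρ u w * δ u w
          + θ * ∑ w ∈ EW, ρ u w * ((g' (m u + θ' * ℓ' w) - g' (m u)) * δ u w)
          + ∑ w ∈ EW, ρ u w * (∑ v ∈ EV, (κB u w v - κA u w v) * g (m u + θ' * ℓ' w + θ * ℓ v)
              - θ * g' (m u + θ' * ℓ' w) * δ u w) := by
      rw [mul_sum, mul_sum, ← sum_add_distrib, ← sum_add_distrib]
      refine sum_congr rfl fun w _ => ?_
      ring
    rw [hdecomp]
    have h1 : |θ * g' (m u) * ∑ w ∈ EW, ρ u w * δ u w| ≤ G₁ * |θ| * |∑ w ∈ EW, ρ u w * δ u w| := by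
      rw [abs_mul, abs_mul, mul_comm |θ|]
      gcongr
      exact hg' _
    have h2 : |θ * ∑ w ∈ EW, ρ u w * ((g' (m u + θ' * ℓ' w) - g' (m u)) * δ u w)|
        ≤ G₂ * |θ| * |θ'| * ∑ w ∈ EW, ρ u w * (|δ u w| * |ℓ' w|) := by
      rw [abs_mul]
      calc |θ| * |∑ w ∈ EW, ρ u w * ((g' (m u + θ' * ℓ' w) - g' (m u)) * δ u w)|
          ≤ |θ| * ∑ w ∈ EW, ρ u w * (G₂ * |θ'| * (|δ u w| * |ℓ' w|)) := by
            refine mul_le_mul_of_nonneg_left ((abs_sum_le_sum_abs _ _).trans (sum_le_sum fun w hw => ?_)) (abs_nonneg θ)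
            rw [abs_mul, abs_of_nonneg (hρ u hu w hw), abs_mul]
            refine mul_le_mul_of_nonneg_left ?_ (hρ u hu w hw)
            calc |g' (m u + θ' * ℓ' w) - g' (m u)| * |δ u w| ≤ G₂ * |m u + θ' * ℓ' w - m u| * |δ u w| :=
                  mul_le_mul_of_nonneg_right (hg'L _ _) (abs_nonneg _)
              _ = G₂ * |θ'| * (|δ u w| * |ℓ' w|) := by rw [add_sub_cancel_left, abs_mul]; ring
        _ = G₂ * |θ| * |θ'| * ∑ w ∈ EW, ρ u w * (|δ u w| * |ℓ' w|) := by
            rw [mul_sum, mul_sum]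
            refine sum_congr rfl fun w _ => ?_
            ring
    have h3 : |∑ w ∈ EW, ρ u w * (∑ v ∈ EV, (κB u w v - κA u w v) * g (m u + θ' * ℓ' w + θ * ℓ v)
          - θ * g' (m u + θ' * ℓ' w) * δ u w)| ≤ G₂ * θ ^ 2 * ∑ w ∈ EW, ρ u w * μ₂ u w := by
      calc |∑ w ∈ EW, ρ u w * (∑ v ∈ EV, (κB u w v - κA u w v) * g (m u + θ' * ℓ' w + θ * ℓ v)
              - θ * g' (m u + θ' * ℓ' w) * δ u w)|
          ≤ ∑ w ∈ EW, ρ u w * (G₂ * θ ^ 2 * μ₂ u w) := by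
            refine (abs_sum_le_sum_abs _ _).trans (sum_le_sum fun w hw => ?_)
            rw [abs_mul, abs_of_nonneg (hρ u hu w hw)]
            exact mul_le_mul_of_nonneg_left (hinner u hu w hw) (hρ u hu w hw)
        _ = G₂ * θ ^ 2 * ∑ w ∈ EW, ρ u w * μ₂ u w := by
            rw [mul_sum]
            refine sum_congr rfl fun w _ => ?_
            ring
    calc |θ * g' (m u) * ∑ w ∈ EW, ρ u w * δ u w
          + θ * ∑ w ∈ EW, ρ u w * ((g' (m u + θ' * ℓ' w) - g' (m u)) * δ u w)
          + ∑ w ∈ EW, ρ u w * (∑ v ∈ EV, (κB u w v - κA u w v) * g (m u + θ' * ℓ' w + θ * ℓ v)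
              - θ * g' (m u + θ' * ℓ' w) * δ u w)|
        ≤ |θ * g' (m u) * ∑ w ∈ EW, ρ u w * δ u w|
          + |θ * ∑ w ∈ EW, ρ u w * ((g' (m u + θ' * ℓ' w) - g' (m u)) * δ u w)|
          + |∑ w ∈ EW, ρ u w * (∑ v ∈ EV, (κB u w v - κA u w v) * g (m u + θ' * ℓ' w + θ * ℓ v)
              - θ * g' (m u + θ' * ℓ' w) * δ u w)| := abs_add_three _ _ _
      _ ≤ _ := add_le_add_three h1 h2 h3
  -- (3) sum over the outer fibres with weights `ν ≥ 0`
  calc |∑ u ∈ EU, ν u * ∑ w ∈ EW, ρ u w * ∑ v ∈ EV, (κB u w v - κA u w v) * g (m u + θ' * ℓ' w + θ * ℓ v)|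
      ≤ ∑ u ∈ EU, ν u * |∑ w ∈ EW, ρ u w * ∑ v ∈ EV, (κB u w v - κA u w v) * g (m u + θ' * ℓ' w + θ * ℓ v)| := by
        refine (abs_sum_le_sum_abs _ _).trans (le_of_eq (sum_congr rfl fun u hu => ?_))
        rw [abs_mul, abs_of_nonneg (hν u hu)]
    _ ≤ ∑ u ∈ EU, ν u * (G₁ * |θ| * |∑ w ∈ EW, ρ u w * δ u w|
          + G₂ * |θ| * |θ'| * ∑ w ∈ EW, ρ u w * (|δ u w| * |ℓ' w|)
          + G₂ * θ ^ 2 * ∑ w ∈ EW, ρ u w * μ₂ u w) :=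
        sum_le_sum fun u hu => mul_le_mul_of_nonneg_left (houter u hu) (hν u hu)
    _ = G₁ * |θ| * ∑ u ∈ EU, ν u * |∑ w ∈ EW, ρ u w * δ u w|
        + G₂ * |θ| * |θ'| * ∑ u ∈ EU, ν u * ∑ w ∈ EW, ρ u w * (|δ u w| * |ℓ' w|)
        + G₂ * θ ^ 2 * ∑ u ∈ EU, ν u * ∑ w ∈ EW, ρ u w * μ₂ u w := by
        rw [mul_sum, mul_sum, mul_sum, ← sum_add_distrib, ← sum_add_distrib]
        refine sum_congr rfl fun u _ => ?_
        ring

/-- **CENTRED OVER THE NEXT LEVEL ⇒ THE FLATNESS CHANNEL IS SECOND ORDER (`θ·θ'`).**  If the slot's conditional-mean discrepancy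
averages to zero over the next-level variable, `Σ_w ρ_{uw}·δ(u,w) = 0` for every `u` (the idealised case: the conditional-mean shift off
the flat orbit is EXACTLY a centred functional of the younger fluctuation — in general only at leading order, the residual being R28 (2)'s
regenerated constant), then the whole swap is second order:
`≤ G₂·|θ|·|θ'|·Σ_u ν_u Σ_w ρ_{uw}|δ(u,w)|·|ℓ' w| + G₂·θ²·(second moments)`.  With `θ = θ₁^{K−j}`, `θ' = θ₁^{K−j'}` (`j < j'`) and the
younger driver LOCAL to the slot (bounded multiplicity per slot) the first summand has the slice profile
`θ₁^{(K−j)+(K−j')}·Λ^{K−j} = (θ₁²Λ)^{K−j}·θ₁^{−(j'−j)}` — geometric when the driver is younger by a bounded number of levels, with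
[B13]-type decay in `j' − j` needed otherwise — booked by the producer (NE1.md R28 (2): «regenerated constants = covariances ≍
θ₁^{(K−j)+(K−k)}»); NOT asserted here beyond the finite model. [folklore] -/
theorem abs_fibred_swap_two_level_le_of_centred
    (hν : ∀ u ∈ EU, 0 ≤ ν u) (hρ : ∀ u ∈ EU, ∀ w ∈ EW, 0 ≤ ρ u w)
    (hκA : ∀ u ∈ EU, ∀ w ∈ EW, ∀ v ∈ EV, 0 ≤ κA u w v) (hκB : ∀ u ∈ EU, ∀ w ∈ EW, ∀ v ∈ EV, 0 ≤ κB u w v)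
    (hmass : ∀ u ∈ EU, ∀ w ∈ EW, ∑ v ∈ EV, κA u w v = ∑ v ∈ EV, κB u w v)
    (hcentred : ∀ u ∈ EU, ∑ w ∈ EW, ρ u w * ∑ v ∈ EV, (κB u w v - κA u w v) * ℓ v = 0)
    (hg : ∀ x h : ℝ, |g (x + h) - g x - h * g' x| ≤ G₂ * h ^ 2) (hg' : ∀ x, |g' x| ≤ G₁)
    (hg'L : ∀ x y : ℝ, |g' x - g' y| ≤ G₂ * |x - y|) :
    |∑ u ∈ EU, ν u * ∑ w ∈ EW, ρ u w * ∑ v ∈ EV, (κB u w v - κA u w v) * g (m u + θ' * ℓ' w + θ * ℓ v)|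
      ≤ G₂ * |θ| * |θ'| * ∑ u ∈ EU, ν u * ∑ w ∈ EW, ρ u w * (|∑ v ∈ EV, (κB u w v - κA u w v) * ℓ v| * |ℓ' w|)
        + G₂ * θ ^ 2 * ∑ u ∈ EU, ν u * ∑ w ∈ EW, ρ u w * ∑ v ∈ EV, (κA u w v + κB u w v) * ℓ v ^ 2 := by
  have h := abs_fibred_swap_two_level_le (m := m) (ℓ' := ℓ') (ℓ := ℓ) (θ := θ) (θ' := θ') hν hρ hκA hκB hmass hg hg' hg'L
  have h0 : ∑ u ∈ EU, ν u * |∑ w ∈ EW, ρ u w * ∑ v ∈ EV, (κB u w v - κA u w v) * ℓ v| = 0 :=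
    sum_eq_zero fun u hu => by rw [hcentred u hu, abs_zero, mul_zero]
  rw [h0, mul_zero, zero_add] at h
  exact h

end Cascade

end Summit.QuantumFields.BalabanUV.T4Continuum.NE1p.TiltedMeanSmoothDualCascade

end
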